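import Summits.QuantumFields.BalabanUV.Beta.SpineRecursiveW
import Summits.QuantumFields.BalabanUV.Beta.SpineRecursiveRemainder
import Summits.QuantumFields.BalabanUV.Beta.SpineRecursivePureLaws
import Summits.QuantumFields.BalabanUV.Beta.SecondOrderSymContact
import Summits.QuantumFields.BalabanUV.Beta.LagrangeFoldSrec

/-!
# `BalabanUV.Beta.SpineRecursiveWEnd` — binder row D1, (L4) piece (W-ASM): **hR FOR THE W-INSTANTIATED RECURSIVE WALL FAMILY `JsRecWAtOf` ⟸ THE
# SECOND-ORDER LETTERS (similarity shape) + THE ASSEMBLED SPLIT + THE RESIDUAL'S LOCALISATION/TADPOLE** — the wiring of `…_closed_bcj_rem` at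
# `W := WrecAt` (β sub-cell, row BETA-an2 = BINDER-OWNERS row D1 OWNER, lineage an2 gen 17; memo `SKELETON-D1-L4.v1` §3 (W-ASM))

HONEST FRAMING (cell charter, verbatim): «discharging BetaPertH makes Balaban's UV stability UNCONDITIONAL — a real
constructive-QFT result; it is NOT the continuum limit and NOT the Clay problem.»  DERIVED cell leaf: no statement of Bałaban's papers is typed
here, no `[cite:]` tag, no `def`, no `Prop` fact; instantiates no binder of the wall by itself.  NOT D1, NOT `BetaPertH`, NOT continuum, NOT Clay.

## What is here ([folklore] wiring; `d + 1 = 4`, odd `Lc`, centred root `ρ_c`, pin `(cE, cVH) = (Lc⁴, −Lc⁸/2)`, `G_j = coDressKBmAt ρ_c Lc (KInvStep Lc j)`)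

* `SpureRecAt_bref`: the (Sr-conj) law of EVERY unfolded field table of the W-literal (`SpineRecursivePureLaws.pureZero/Succ_bref`), contact
  `conjV (bhKStepAt j) (diagK (γ_j·ctGen))`; `vertexOfK_diagK_family` / `vertexOfK_smul_diagK_ctGen` (the hR END's contact letter
  `vertexOfK G_j Lc (γ_j • diagK ctGen) b` IS `diagK` of the dressed symbol); `dM_SpureRecAt_M1At` ((c1) at every level: leaf-10's
  `LagrangeFoldSrec.vertexOfK_S0NAt_split` / `vertexOfK_SrecAt_succ_split`); `diagK_sub`.
* **`axisReflectionCovariant_flipK_TbalOf_JsRecWAtOf`**: `∀ j, AxisReflectionCovariant (flipK (TbalOf Lc (JsRecWAtOf …) j))` from EXACTLY: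
  (hT2) the sharp law of `T2RecAt j` with ♯-bi-table `T2RecAt j + conjW (bhKStepAt j) (Sp κ u) (Sp κ′ u′) (diagK g_{κu}) (diagK g_{κ′u′}) (diagK h…)` (LETTER, similarity shape),
  (hM2) the sharp law of `M2Of mixFF j` with ♯-table `M2Of … + conjV (M1At j ρ w) (diagK g_{κu})` (LETTER),
  (hsplit) the assembled identity of `SecondOrderContactAssembly.W2OfK_sharp_split` at every `(j, α, b, c)` (its analytic binders discharged by the
  user; `X2s`, `Δ` its second symbol and residual), (hDg) `Loc (dM G_j Lc S♯ (M1At j) ·)`, (hX2L) `Loc (diagK (X2s …))`, (hΔL) `Loc (Δ …)`,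
  (hΔ0) `tadpole G_j (Δ …) = 0` (leaf-05's `SpineRecursiveParity.tadpole_dM_eq_zero_of_rows` for `Δ = dM (Ξ c) …`).
  Inside: `SecondOrderTransport.W2SymOfK_bref_sharp`, `SecondOrderSymContact.W2SymOfK_sharp_split_of`, `tadpole_conjV_rel_eq_zero`
  (`relInv_coDressKBmAt_KInvStep_bhKStepAt`, `comp_axEc_diagK_comm`), and `SpineRecursiveRemainder.…_closed_bcj_rem` with
  `X₂ := diagK (X2s b c)`, `Rm := ½•conjV 𝕄_j (diagK (X2s c b − X2s b c)) + ½•(Δ b c + Δ c b)`.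
NOT HERE: the letters themselves ((W-LET-S₂) an3/an1/an2, (W-LET-M₂) an1), the locks (W-L) (they enter through hT2's level-(j+1) instance), the
discharge of `hsplit`'s analytic binders from decay.  Provenance: β sub-cell, unit beta-an2 gen 17, 2026-08-20 (v1); no existing file touched.
-/

open Finset
open scoped BigOperators
open Literature.MathematicalPhysics.QuantumFieldTheory
open Literature.MathematicalPhysics.QuantumFieldTheory.Balaban1983to89
open Literature.MathematicalPhysics.QuantumFieldTheory.Balaban1983to89.Beta
open ExpKernelCalculus (MKer Decays BiLoc comp tadpole VertexFamily VertexFamily₂ shiftK)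
open AffineAveraging (box toSite)
open AveragingContoursRooted (ctr ctrOff ctrOff_mem_box)
open PolarizationSign (reflSign AxisReflectionCovariant)
open KernelReflection (refK refK_apply)
open ResolventReflection (bref Φ)
open OneStepResolventKernel (Fib LocStencil JetData wsum)
open OneStepKernelFamily (KInvStep colH vertexOfK TbalOf flipK)
open BalabanStepJetsSucc (wE wVH)
open BalabanCompositeJets (LocStencil₂)
open BalabanStepW2 (M2Of)
open SecondOrderResponse (dM W2OfK W2SymOfK LocStencilFM)
open Summit.QuantumFields.BalabanUV.Beta.TameKernelCalculus
open Summit.QuantumFields.BalabanUV.Beta.ChartConjugation (conjV conjW loc_conjV)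
open Summit.QuantumFields.BalabanUV.Beta.ChartConjugationRelative (RelInv)
open Summit.QuantumFields.BalabanUV.Beta.AxialDressingRooted (coDressKBmAt axEc spr_axEc one_le_of_neZero refK_coDressKBmAt_KInvStep)
open Summit.QuantumFields.BalabanUV.Beta.BorderedHessian (diagK diagK_apply ctGen comp_axEc_diagK_comm bhKStepAt stepScale spr_bhKStepAt
  relInv_coDressKBmAt_KInvStep_bhKStepAt)
open Summit.QuantumFields.BalabanUV.Beta.WardLocusRecursive (SrecAt SrecAt_zero)
open Summit.QuantumFields.BalabanUV.Beta.VertexReflectionContact (smul_diagK)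
open Summit.QuantumFields.BalabanUV.Beta.SecondOrderTransport (W2SymOfK_bref_sharp)
open Summit.QuantumFields.BalabanUV.Beta.SecondOrderSymContact (W2SymOfK_sharp_split_of tadpole_conjV_rel_eq_zero tadpole_rem_eq_zero loc_rem)
open Summit.QuantumFields.BalabanUV.Beta.LagrangeFoldSrec (vertexOfK_S0NAt_split vertexOfK_SrecAt_succ_split)

noncomputable section

namespace Summit.QuantumFields.BalabanUV.Beta.SpineRooted

variable {d : ℕ}

/-! ## §1 Bricks -/

/-- [folklore] The chain-rule vertex of a family of DIAGONAL kernels is the diagonal kernel of the dressed symbol (no summability). -/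
theorem vertexOfK_diagK_family (K : MKer (d + 1) (Fib d)) (N : ℕ) (g : Fin (d + 1) → (Fin (d + 1) → ℤ) → (Fin (d + 1) → ℤ) → Fib d → ℝ)
    (μ : Fin (d + 1)) (y : Fin (d + 1) → ℤ) :
    vertexOfK K N (fun κ u => diagK (g κ u)) μ y = diagK fun p c => ∑ κ, ∑' u, colH K N μ y κ u * g κ u p c := by
  classical
  funext x z a b
  simp only [vertexOfK, OneStepResolventKernel.wsum, diagK_apply]
  split_ifs with hxz
  · rfl
  · simp only [mul_zero, tsum_zero, Finset.sum_const_zero]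

/-- [folklore] **THE hR END's CONTACT LETTER IS THE DIAGONAL OF THE DRESSED GENERATOR**:
`vertexOfK K N (κ u ↦ γ • diagK (ctGen d α L κ u)) b = diagK (p c ↦ Σ_κ Σ'_u colH K N b κ u · (γ · ctGen d α L κ u p c))`. -/
theorem vertexOfK_smul_diagK_ctGen (K : MKer (d + 1) (Fib d)) (N L : ℕ) (γ : ℝ) (α μ : Fin (d + 1)) (y : Fin (d + 1) → ℤ) :
    vertexOfK K N (fun κ u => γ • diagK (ctGen d α L κ u)) μ y =
      diagK fun p c => ∑ κ, ∑' u, colH K N μ y κ u * (γ * ctGen d α L κ u p c) := by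
  have e : (fun κ u => γ • diagK (ctGen d α L κ u)) = fun κ u => diagK (fun p c => γ * ctGen d α L κ u p c) := by
    funext κ u; exact smul_diagK γ _
  rw [e, vertexOfK_diagK_family]

/-- [folklore] `diagK` is additive/subtractive in the symbol. -/
theorem diagK_sub (f g : (Fin (d + 1) → ℤ) → Fib d → ℝ) : (diagK fun p a => f p a - g p a) = diagK f - diagK g := by
  classical
  funext x z a b
  simp only [diagK_apply, Pi.sub_apply]
  split_ifs <;> simp

section Wall

variable {Lc : ℕ} [NeZero Lc]

/-- [folklore] **(Sr-conj) OF EVERY UNFOLDED FIELD TABLE OF THE W-LITERAL** (`SpureRecAt`, centred root; `SpineRecursivePureLaws` by cases on the level;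
the contact `γ_j • diagK ctGen` rewritten as `diagK (γ_j · ctGen)`). -/
theorem SpureRecAt_bref (hLc : Odd Lc) (cE cVH cΛ : ℝ) (hn : 2 * cVH = -(cE * (Lc : ℝ) ^ 4)) (γ : ℕ → ℝ)
    (hγ : ∀ j, γ j = cVH * wVH 3 Lc j / (stepScale 3 Lc j * (Lc : ℝ) ^ 4))
    (hlock : ∀ j, cE * wE 3 Lc (j + 1) * (γ j / (stepScale 3 Lc j * (Lc : ℝ) ^ 4 * wVH 3 Lc (j + 1))) = γ (j + 1)) :
    ∀ (j : ℕ) (α κ : Fin 4) (u : Fin 4 → ℤ),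
      SpureRecAt 3 Lc (toSite (ctrOff 4 Lc)) cE cVH cΛ j κ (bref α κ u) =
        reflSign α κ • refK (Φ Lc α) (SpureRecAt 3 Lc (toSite (ctrOff 4 Lc)) cE cVH cΛ j κ u +
          conjV (bhKStepAt 3 (toSite (ctrOff 4 Lc)) Lc j) (diagK fun p c => γ j * ctGen 3 α Lc κ u p c))
  | 0, α, κ, u => by
    rw [← smul_diagK, SpureRecAt_zero_level]
    exact pureZero_bref hLc cE cVH cΛ hn γ hγ hlock α κ u
  | j + 1, α, κ, u => by
    rw [← smul_diagK, SpureRecAt_succ]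
    exact pureSucc_bref hLc cE cVH cΛ hn γ hγ hlock j α κ u

omit [NeZero Lc] in
/-- [folklore] **(c1) AT EVERY LEVEL**: `dM G_j Lc (SpureRecAt j) (M1At j) b = vertexOfK G_j Lc (SrecAt j) b` (in-block root; leaf-10's splits). -/
theorem dM_SpureRecAt_M1At [NeZero Lc] {r : Fin (d + 1) → ℕ} (hr : r ∈ box (d + 1) Lc) (cE cVH cΛ : ℝ) :
    ∀ (j : ℕ) (μ : Fin (d + 1)) (y : Fin (d + 1) → ℤ),
      dM (coDressKBmAt (toSite r) Lc (KInvStep (d := d) Lc j)) Lc (SpureRecAt d Lc (toSite r) cE cVH cΛ j) (M1At d Lc (toSite r) cΛ j) μ y =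
        vertexOfK (coDressKBmAt (toSite r) Lc (KInvStep (d := d) Lc j)) Lc (SrecAt d Lc (toSite r) cE cVH cΛ j) μ y
  | 0, μ, y => by rw [SecondOrderResponse.dM, SpureRecAt_zero_level, SrecAt_zero, vertexOfK_S0NAt_split hr cE cVH cΛ μ y]
  | j + 1, μ, y => by rw [SecondOrderResponse.dM, SpureRecAt_succ, vertexOfK_SrecAt_succ_split hr cE cVH cΛ j μ y]

/-! ## §2 The END for the W-instantiated recursive wall family -/

/-- [folklore] **hR FOR `JsRecWAtOf` ⟸ THE SECOND-ORDER LETTERS + THE ASSEMBLED SPLIT + THE RESIDUAL'S LOCALISATION AND TADPOLE** (see the module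
docstring for the exact list; every hypothesis is a BINDER, discharged by nothing in this file). -/
theorem axisReflectionCovariant_flipK_TbalOf_JsRecWAtOf (hLc : Odd Lc) (cΛ cE₂ cB : ℝ) (T : Fin 4 → Fin 4 → Fin 4 → Fin 4 → ℝ)
    {vh₂S : Fin 4 → (Fin 4 → ℤ) → Fin 4 → (Fin 4 → ℤ) → MKer 4 (Fib 3)} (hB : ∃ C δ : ℝ, 0 < δ ∧ LocStencil₂ vh₂S C δ)
    {mixFF : Fin 4 → (Fin 4 → ℤ) → Fin 4 → (Fin 4 → ℤ) → MKer 4 (Fib 3)} (hmix : ∃ C δ : ℝ, 0 < δ ∧ LocStencilFM Lc mixFF C δ)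
    (hBt : ∀ (κ : Fin 4) (u : Fin 4 → ℤ) (κ' : Fin 4) (u' t : Fin 4 → ℤ),
      vh₂S κ (u + (Lc : ℤ) • t) κ' (u' + (Lc : ℤ) • t) = shiftK (-((Lc : ℤ) • t)) (vh₂S κ u κ' u'))
    (hmixt : ∀ (κ : Fin 4) (u : Fin 4 → ℤ) (μ : Fin 4) (w t : Fin 4 → ℤ),
      mixFF κ (u + (Lc : ℤ) • t) μ (w + t) = shiftK (-((Lc : ℤ) • t)) (mixFF κ u μ w))
    (γ : ℕ → ℝ) (hγ : ∀ j, γ j = -((Lc : ℝ) ^ 8 / 2) * wVH 3 Lc j / (stepScale 3 Lc j * (Lc : ℝ) ^ 4))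
    (h : ℕ → Fin 4 → Fin 4 → (Fin 4 → ℤ) → Fin 4 → (Fin 4 → ℤ) → (Fin 4 → ℤ) → Fib 3 → ℝ)
    (hT2 : ∀ (j : ℕ) (α κ : Fin 4) (u : Fin 4 → ℤ) (κ' : Fin 4) (u' : Fin 4 → ℤ),
      T2RecAt 3 Lc (toSite (ctrOff 4 Lc)) ((Lc : ℝ) ^ 4) (-((Lc : ℝ) ^ 8 / 2)) cΛ cE₂ cB T vh₂S mixFF j κ (bref α κ u) κ' (bref α κ' u') =
        (reflSign α κ * reflSign α κ') • refK (Φ Lc α)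
          (T2RecAt 3 Lc (toSite (ctrOff 4 Lc)) ((Lc : ℝ) ^ 4) (-((Lc : ℝ) ^ 8 / 2)) cΛ cE₂ cB T vh₂S mixFF j κ u κ' u' +
            conjW (bhKStepAt 3 (toSite (ctrOff 4 Lc)) Lc j)
              (SpureRecAt 3 Lc (toSite (ctrOff 4 Lc)) ((Lc : ℝ) ^ 4) (-((Lc : ℝ) ^ 8 / 2)) cΛ j κ u)
              (SpureRecAt 3 Lc (toSite (ctrOff 4 Lc)) ((Lc : ℝ) ^ 4) (-((Lc : ℝ) ^ 8 / 2)) cΛ j κ' u')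
              (diagK fun p c => γ j * ctGen 3 α Lc κ u p c) (diagK fun p c => γ j * ctGen 3 α Lc κ' u' p c) (diagK (h j α κ u κ' u'))))
    (hM2 : ∀ (j : ℕ) (α κ : Fin 4) (u : Fin 4 → ℤ) (ρ : Fin 4) (w : Fin 4 → ℤ),
      M2Of 3 Lc mixFF j κ (bref α κ u) ρ (bref α ρ w) =
        (reflSign α κ * reflSign α ρ) • refK (Φ Lc α)
          (M2Of 3 Lc mixFF j κ u ρ w + conjV (M1At 3 Lc (toSite (ctrOff 4 Lc)) cΛ j ρ w) (diagK fun p c => γ j * ctGen 3 α Lc κ u p c)))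
    (X2s : ℕ → Fin 4 → Fin 4 → (Fin 4 → ℤ) → Fin 4 → (Fin 4 → ℤ) → (Fin 4 → ℤ) → Fib 3 → ℝ)
    (Δ : ℕ → Fin 4 → Fin 4 → (Fin 4 → ℤ) → Fin 4 → (Fin 4 → ℤ) → MKer 4 (Fib 3))
    (hsplit : ∀ (j : ℕ) (α μ : Fin 4) (y : Fin 4 → ℤ) (ν : Fin 4) (y' : Fin 4 → ℤ),
      W2OfK (coDressKBmAt (toSite (ctrOff 4 Lc)) Lc (KInvStep (d := 3) Lc j)) Lc
          (fun κ u => SpureRecAt 3 Lc (toSite (ctrOff 4 Lc)) ((Lc : ℝ) ^ 4) (-((Lc : ℝ) ^ 8 / 2)) cΛ j κ u +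
            conjV (bhKStepAt 3 (toSite (ctrOff 4 Lc)) Lc j) (diagK fun p c => γ j * ctGen 3 α Lc κ u p c))
          (M1At 3 Lc (toSite (ctrOff 4 Lc)) cΛ j)
          (fun κ u κ' u' => T2RecAt 3 Lc (toSite (ctrOff 4 Lc)) ((Lc : ℝ) ^ 4) (-((Lc : ℝ) ^ 8 / 2)) cΛ cE₂ cB T vh₂S mixFF j κ u κ' u' +
            conjW (bhKStepAt 3 (toSite (ctrOff 4 Lc)) Lc j)
              (SpureRecAt 3 Lc (toSite (ctrOff 4 Lc)) ((Lc : ℝ) ^ 4) (-((Lc : ℝ) ^ 8 / 2)) cΛ j κ u)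
              (SpureRecAt 3 Lc (toSite (ctrOff 4 Lc)) ((Lc : ℝ) ^ 4) (-((Lc : ℝ) ^ 8 / 2)) cΛ j κ' u')
              (diagK fun p c => γ j * ctGen 3 α Lc κ u p c) (diagK fun p c => γ j * ctGen 3 α Lc κ' u' p c) (diagK (h j α κ u κ' u')))
          (fun κ u ρ w => M2Of 3 Lc mixFF j κ u ρ w + conjV (M1At 3 Lc (toSite (ctrOff 4 Lc)) cΛ j ρ w) (diagK fun p c => γ j * ctGen 3 α Lc κ u p c))
          μ y ν y' =
        W2OfK (coDressKBmAt (toSite (ctrOff 4 Lc)) Lc (KInvStep (d := 3) Lc j)) Lc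
            (SpureRecAt 3 Lc (toSite (ctrOff 4 Lc)) ((Lc : ℝ) ^ 4) (-((Lc : ℝ) ^ 8 / 2)) cΛ j) (M1At 3 Lc (toSite (ctrOff 4 Lc)) cΛ j)
            (T2RecAt 3 Lc (toSite (ctrOff 4 Lc)) ((Lc : ℝ) ^ 4) (-((Lc : ℝ) ^ 8 / 2)) cΛ cE₂ cB T vh₂S mixFF j) (M2Of 3 Lc mixFF j) μ y ν y' +
          conjW (bhKStepAt 3 (toSite (ctrOff 4 Lc)) Lc j)
            (dM (coDressKBmAt (toSite (ctrOff 4 Lc)) Lc (KInvStep (d := 3) Lc j)) Lc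
              (SpureRecAt 3 Lc (toSite (ctrOff 4 Lc)) ((Lc : ℝ) ^ 4) (-((Lc : ℝ) ^ 8 / 2)) cΛ j) (M1At 3 Lc (toSite (ctrOff 4 Lc)) cΛ j) μ y)
            (dM (coDressKBmAt (toSite (ctrOff 4 Lc)) Lc (KInvStep (d := 3) Lc j)) Lc
              (SpureRecAt 3 Lc (toSite (ctrOff 4 Lc)) ((Lc : ℝ) ^ 4) (-((Lc : ℝ) ^ 8 / 2)) cΛ j) (M1At 3 Lc (toSite (ctrOff 4 Lc)) cΛ j) ν y')
            (diagK fun p c => ∑ κ, ∑' u, colH (coDressKBmAt (toSite (ctrOff 4 Lc)) Lc (KInvStep (d := 3) Lc j)) Lc μ y κ u * (γ j * ctGen 3 α Lc κ u p c))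
            (diagK fun p c => ∑ κ, ∑' u, colH (coDressKBmAt (toSite (ctrOff 4 Lc)) Lc (KInvStep (d := 3) Lc j)) Lc ν y' κ u * (γ j * ctGen 3 α Lc κ u p c))
            (diagK (X2s j α μ y ν y')) +
          Δ j α μ y ν y')
    (hDg : ∀ (j : ℕ) (α ν : Fin 4) (y' : Fin 4 → ℤ),
      Loc (dM (coDressKBmAt (toSite (ctrOff 4 Lc)) Lc (KInvStep (d := 3) Lc j)) Lc
        (fun κ u => SpureRecAt 3 Lc (toSite (ctrOff 4 Lc)) ((Lc : ℝ) ^ 4) (-((Lc : ℝ) ^ 8 / 2)) cΛ j κ u +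
          conjV (bhKStepAt 3 (toSite (ctrOff 4 Lc)) Lc j) (diagK fun p c => γ j * ctGen 3 α Lc κ u p c))
        (M1At 3 Lc (toSite (ctrOff 4 Lc)) cΛ j) ν y'))
    (hX2L : ∀ j α μ y ν y', Loc (diagK (X2s j α μ y ν y'))) (hΔL : ∀ j α μ y ν y', Loc (Δ j α μ y ν y'))
    (hΔ0 : ∀ j α μ y ν y', tadpole (coDressKBmAt (toSite (ctrOff 4 Lc)) Lc (KInvStep (d := 3) Lc j)) (Δ j α μ y ν y') = 0) :
    ∀ j : ℕ, AxisReflectionCovariant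
      (flipK (TbalOf Lc (JsRecWAtOf (d := 3) hLc.pos (ctrOff_mem_box hLc.pos) ((Lc : ℝ) ^ 4) (-((Lc : ℝ) ^ 8 / 2)) cΛ cE₂ cB T hB hmix) j)) := by
  have hL1 : 1 ≤ Lc := hLc.pos
  have hr := ctrOff_mem_box (d := 4) hL1
  rw [JsRecWAtOf_eq]
  have hRel := relInv_coDressKBmAt_KInvStep_bhKStepAt (d := 3) (Lc := Lc) hr
  have hn : 2 * (-((Lc : ℝ) ^ 8 / 2)) = -((Lc : ℝ) ^ 4 * (Lc : ℝ) ^ 4) := by ring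
  have hlock : ∀ j, (Lc : ℝ) ^ 4 * wE 3 Lc (j + 1) * (γ j / (stepScale 3 Lc j * (Lc : ℝ) ^ 4 * wVH 3 Lc (j + 1))) = γ (j + 1) := by
    intro j; rw [hγ, hγ]; exact locks_of_pin (Lc := Lc) ((Lc : ℝ) ^ 4) (-((Lc : ℝ) ^ 8 / 2)) (pin_of_bcj (Lc := Lc) _ rfl) j
  have hSp := SpureRecAt_bref hLc ((Lc : ℝ) ^ 4) (-((Lc : ℝ) ^ 8 / 2)) cΛ hn γ hγ hlock
  -- the localised difference of the two second symbols and its properties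
  have hdiff : ∀ j α μ y ν y', Loc (diagK fun p a => X2s j α ν y' μ y p a - X2s j α μ y ν y' p a) := fun j α μ y ν y' => by
    rw [diagK_sub]; exact (hX2L j α ν y' μ y).sub (hX2L j α μ y ν y')
  have hEdiff : ∀ j α μ y ν y', comp (axEc (toSite (ctrOff 4 Lc)) Lc) (diagK fun p a => X2s j α ν y' μ y p a - X2s j α μ y ν y' p a) =
      comp (diagK fun p a => X2s j α ν y' μ y p a - X2s j α μ y ν y' p a) (axEc (toSite (ctrOff 4 Lc)) Lc) :=
    fun j α μ y ν y' => comp_axEc_diagK_comm _ _ _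
  refine axisReflectionCovariant_flipK_TbalOf_JsRecBmAtOf_ctrC_closed_bcj_rem hLc cΛ _ _ _ _ _
    (WrecAt_translate (toSite (ctrOff 4 Lc)) ((Lc : ℝ) ^ 4) (-((Lc : ℝ) ^ 8 / 2)) cΛ cE₂ cB T vh₂S mixFF hL1 hBt hmixt) γ hγ
    (fun j α μ y ν y' => diagK (X2s j α μ y ν y'))
    (fun j α μ y ν y' => (1 / 2 : ℝ) • conjV (bhKStepAt 3 (toSite (ctrOff 4 Lc)) Lc j) (diagK fun p a => X2s j α ν y' μ y p a - X2s j α μ y ν y' p a) +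
      (1 / 2 : ℝ) • (Δ j α μ y ν y' + Δ j α ν y' μ y))
    (fun j α μ y ν y' => hX2L j α μ y ν y') (fun j α μ y ν y' => comp_axEc_diagK_comm _ _ _)
    (fun j α μ y ν y' => loc_rem (loc_conjV (spr_bhKStepAt hr j) (hdiff j α μ y ν y')) (hΔL j α μ y ν y') (hΔL j α ν y' μ y))
    (fun j α μ y ν y' => tadpole_rem_eq_zero (spr_stepProp hr j) (loc_conjV (spr_bhKStepAt hr j) (hdiff j α μ y ν y')) (hΔL j α μ y ν y')
      (hΔL j α ν y' μ y) (tadpole_conjV_rel_eq_zero (spr_stepProp hr j) (spr_bhKStepAt hr j) (spr_axEc _ _) (hRel j) (hdiff j α μ y ν y')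
        (hEdiff j α μ y ν y')) (hΔ0 j α μ y ν y') (hΔ0 j α ν y' μ y))
    fun j α μ y ν y' => ?_
  -- the conjugated second-order law of the W-literal
  rw [JsRec0AtOf_W, JsRec0AtOf_S]
  show W2SymOfK _ Lc _ _ _ _ μ (bref α μ y) ν (bref α ν y') = _
  rw [W2SymOfK_bref_sharp (refK_coDressKBmAt_KInvStep (d := 3) hLc j α) (spr_stepProp hr j) (hSp j α) (M1At_bref (d := 3) hLc cΛ j α)
      (hT2 j α) (hM2 j α) (hDg j α) μ y ν y',
    W2SymOfK_sharp_split_of (hsplit j α μ y ν y') (hsplit j α ν y' μ y), dM_SpureRecAt_M1At hr _ _ cΛ j μ y, dM_SpureRecAt_M1At hr _ _ cΛ j ν y',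
    ← vertexOfK_smul_diagK_ctGen, ← vertexOfK_smul_diagK_ctGen]
  rfl

end Wall

end Summit.QuantumFields.BalabanUV.Beta.SpineRooted

end
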